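import Summits.BirchSwinnertonDyer.BirchSwinnertonDyer.Theorems.UniversalToricDescentThinCombWeakReflection
import HarnessLib

/-!
# Thin-comb rigidity for INVOLUTIVE weak reflections: one-sided divisibility is symmetry
# (helper on the rational wall `RationalSplitIMCInclusionAtThree`, item stmt-BirchSwinnertonDyer-24207,
# line `ratwall_thin_comb` v5; cell `pub/bsd-wall`, LEAD `cruxlead-24207` g4; `--supports stmt-BirchSwinnertonDyer-24207`)

WHY THIS FILE. The functional-equation stub `stub_reflectionSymmetryUpTo2` of the line asks for ONE weak reflection `ρ`
of `Λ₂(𝒪) = 𝒪⟦T₂⟧⟦T₁⟧` with `ρ G ∼ G` (K4, algebraic functional equation of the two-variable Selmer dual) and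
`ρ L₂ ∼ L₂` (K3(iii), analytic functional equation of the toric two-variable function), `∼` = `Associated` (equal up to
a UNIT of `Λ₂(𝒪)`). The intended `ρ` is the substitution induced by Büyükboduk–Lei's involution `γ ↦ c γ⁻¹ c` of
`Gal(K̃_∞/K) ≅ ℤ_p²`, hence an INVOLUTION (`ρ ∘ ρ = id`). For an involutive ring automorphism of a domain the unit is
automatic: `Associated (ρ F) F ↔ F ∣ ρ F ↔ ρ F ∣ F` (§1: if `ρ F = h·F` then `F = ρ h · h · F`, so `ρ h · h = 1`), and a
symmetry "up to a power of `p`" collapses to a genuine one (`Associated (ρ F) (p^d·F)` forces `d = 0` or `F = 0`,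
§1). Consequently the two `Associated` hypotheses of the tree's rigidity theorem
`dvd_pow_mul_of_weakReflection` / `dvd_of_weakReflection` (Part VII) may be replaced, for involutive `ρ`, by the
ONE-SIDED divisibilities `G ∣ ρ G`, `F ∣ ρ F` that a functional equation "`ρ F = (explicit bounded factor) · F`"
delivers before any unit bookkeeping (§2). This is the kernel-exact form of the LEAD census g4 remark that the
K3(iii) conjunct is robust against the constant / ε-factor bookkeeping at the additive prime: no `(a, b)`-graded or
constant `p`-power can separate `ρ L₂` from `L₂` once `ρ` is an involution.

CONTENTS (theorems only; nothing about elliptic curves; no `sorry`, no instance, no notation):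
* §1 `associated_map_of_dvd_map`, `associated_map_of_map_dvd`, `associated_map_iff_dvd_map`,
  `associated_map_iff_map_dvd`, `eq_zero_or_eq_zero_of_associated_map_pow_mul` — involutive automorphisms of a domain.
* §2 `dvd_pow_mul_of_involutiveWeakReflection`, `dvd_of_involutiveWeakReflection` — Part VII with one-sided
  symmetry hypotheses, every DVR `𝒪` with maximal ideal `(p)`.

HONEST FRAMING. Algebra only: neither functional equation is proved here, and nothing is claimed about the existence
of the toric two-variable function or of the comb divisibility; BSD is not proved by any of this.
References: Washington §7.1–7.2, §13.4 [cite: Washington1997, §7.1–§7.2 and §13.4]; Büyükboduk–Lei, arXiv:1707.00557,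
Def. 3.8 (the involution `τ`) [cite: BuyukbodukLei2017, Def. 3.8]; Matsumura Thm. 20.3 [cite: Matsumura1987, Thm. 20.3].
-/

set_option linter.dupNamespace false

noncomputable section

namespace Summit.BirchSwinnertonDyer.BirchSwinnertonDyer.Theorems.UniversalToricDescentThinComb.InvolutiveReflection

/-! ## §1 Involutive automorphisms of a domain: one-sided divisibility is symmetry up to a unit -/

section Domain

variable {A : Type*} [CommRing A] [IsDomain A] (ρ : A ≃+* A)

/-- For an INVOLUTIVE ring automorphism `ρ` of a domain, `F ∣ ρ F` already gives `ρ F ∼ F`: writing `ρ F = F·h`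
and applying `ρ` once more, `F = ρ F · ρ h = F · (h · ρ h)`, so `h · ρ h = 1` and `h` is a unit (the case `F = 0` is
trivial). [cite: Washington1997, §13.4 (Γ-action conventions)] -/
theorem associated_map_of_dvd_map (hρ : ∀ x, ρ (ρ x) = x) {F : A} (h : F ∣ ρ F) : Associated (ρ F) F := by
  by_cases hF0 : F = 0
  · subst hF0
    rw [map_zero]
  obtain ⟨h, hh⟩ := h
  have key : F * (h * ρ h) = F * 1 := by
    have := congrArg ρ hh
    rw [hρ, map_mul] at this
    -- this : F = ρ F * ρ h
    rw [mul_one, ← mul_assoc, ← hh]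
    exact this.symm
  have hu : IsUnit h := isUnit_iff_exists_inv.mpr ⟨ρ h, mul_left_cancel₀ hF0 key⟩
  exact ⟨hu.unit⁻¹, by rw [hh, mul_assoc, IsUnit.mul_val_inv, mul_one]⟩

/-- For an involutive ring automorphism `ρ` of a domain, `ρ F ∣ F` gives `ρ F ∼ F` (apply
`associated_map_of_dvd_map` to `ρ F`). [cite: Washington1997, §13.4 (Γ-action conventions)] -/
theorem associated_map_of_map_dvd (hρ : ∀ x, ρ (ρ x) = x) {F : A} (h : ρ F ∣ F) : Associated (ρ F) F := by
  have h' : ρ F ∣ ρ (ρ F) := by rwa [hρ]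
  have := associated_map_of_dvd_map ρ hρ h'
  rw [hρ] at this
  exact this.symm

/-- For an involutive ring automorphism of a domain: `ρ F ∼ F ↔ F ∣ ρ F`.
[cite: Washington1997, §13.4 (Γ-action conventions)] -/
theorem associated_map_iff_dvd_map (hρ : ∀ x, ρ (ρ x) = x) (F : A) : Associated (ρ F) F ↔ F ∣ ρ F :=
  ⟨fun h => h.symm.dvd, associated_map_of_dvd_map ρ hρ⟩

/-- For an involutive ring automorphism of a domain: `ρ F ∼ F ↔ ρ F ∣ F`.
[cite: Washington1997, §13.4 (Γ-action conventions)] -/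
theorem associated_map_iff_map_dvd (hρ : ∀ x, ρ (ρ x) = x) (F : A) : Associated (ρ F) F ↔ ρ F ∣ F :=
  ⟨fun h => h.dvd, associated_map_of_map_dvd ρ hρ⟩

/-- **A symmetry up to a power of a non-unit collapses for involutions.** If `ρ` is involutive and fixes the
non-unit `q` (e.g. `q = p ∈ 𝒪 ⊂ Λ₂(𝒪)`), then `ρ F ∼ q^d · F` forces `d = 0` or `F = 0`: applying `ρ` twice gives
`F ∼ q^{2d} · F`, i.e. `q^{2d}` is a unit. So relaxing K3(iii) to "symmetric up to a power of `p`" gains nothing for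
the intended (involutive) reflection. [cite: Washington1997, §13.4 (Γ-action conventions)] -/
theorem eq_zero_or_eq_zero_of_associated_map_pow_mul (hρ : ∀ x, ρ (ρ x) = x) {q : A} (hq : ¬ IsUnit q)
    (hρq : ρ q = q) {F : A} {d : ℕ} (h : Associated (ρ F) (q ^ d * F)) : d = 0 ∨ F = 0 := by
  by_cases hF0 : F = 0
  · exact Or.inr hF0
  left
  obtain ⟨u, hu⟩ := h
  -- `ρ F * u = q^d * F`; apply `ρ`: `F * ρ u = q^d * ρ F`
  have h2 : F * ρ ↑u = q ^ d * ρ F := by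
    have := congrArg ρ hu
    rwa [map_mul, hρ, map_mul, map_pow, hρq] at this
  -- combine: `F * (ρ u * u) = q^(2d) * F`... more precisely `F * ρu * u = q^d * (ρ F * u) = q^d * q^d * F`
  have h3 : F * (ρ ↑u * ↑u) = F * (q ^ d * q ^ d) := by
    calc F * (ρ ↑u * ↑u) = (F * ρ ↑u) * ↑u := by ring
      _ = q ^ d * (ρ F * ↑u) := by rw [h2]; ring
      _ = q ^ d * (q ^ d * F) := by rw [hu]
      _ = F * (q ^ d * q ^ d) := by ring
  have h4 : ρ ↑u * ↑u = q ^ d * q ^ d := mul_left_cancel₀ hF0 h3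
  have hunit : IsUnit (q ^ d * q ^ d) := by
    rw [← h4]
    exact ((Units.isUnit u).map ρ).mul (Units.isUnit u)
  by_contra hd
  have : IsUnit q := by
    have hqd : IsUnit (q ^ d) := isUnit_of_mul_isUnit_left hunit
    exact (isUnit_pow_iff hd).mp hqd
  exact hq this

end Domain

/-! ## §2 Rigidity for involutive weak reflections with ONE-SIDED symmetry hypotheses -/

section Rigidity

variable (𝒪 : Type*) [CommRing 𝒪] [IsDomain 𝒪] [IsDiscreteValuationRing 𝒪] (p : ℕ) [hp : Fact p.Prime]

/-- **RIGIDITY FOR INVOLUTIVE WEAK REFLECTIONS, rational form.** For every DVR `𝒪` with maximal ideal `(p)`: if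
`ρ` is an involutive ring automorphism of `𝒪⟦T₂⟧⟦T₁⟧` fixing constants with `ρ T₂ ∉ (p, T₂)`, `G ∣ ρ G`, `F ∣ ρ F`
(one-sided forms of the algebraic and analytic functional equations) and `G ∣ p^{t_m} F (mod E_m(T₂))` on comb
levels of unbounded order, then `G ∣ p^a F` for some `a`. (`dvd_pow_mul_of_weakReflection` with §1.)
[cite: Washington1997, §7.1–§7.2 and §13.4; Matsumura1987, Thm. 20.3] -/
theorem dvd_pow_mul_of_involutiveWeakReflection (hmax : IsLocalRing.maximalIdeal 𝒪 = Ideal.span {(p : 𝒪)})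
    (ρ : PowerSeries (PowerSeries 𝒪) ≃+* PowerSeries (PowerSeries 𝒪)) (hρ2 : ∀ x, ρ (ρ x) = x)
    (hρc : ∀ c : 𝒪, ρ (const 𝒪 c) = const 𝒪 c)
    (hρT : ρ (T₂ 𝒪) ∉ Ideal.span {const 𝒪 (p : 𝒪), T₂ 𝒪})
    (G F : PowerSeries (PowerSeries 𝒪)) (hG : G ∣ ρ G) (hF : F ∣ ρ F)
    (hcomb : ThinCombDvdRat 𝒪 p G F) : ∃ a : ℕ, G ∣ const 𝒪 ((p : 𝒪) ^ a) * F :=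
  dvd_pow_mul_of_weakReflection 𝒪 p hmax ρ hρc hρT G F (associated_map_of_dvd_map ρ hρ2 hG)
    (associated_map_of_dvd_map ρ hρ2 hF) hcomb

/-- **RIGIDITY FOR INVOLUTIVE WEAK REFLECTIONS, integral form**: with integral comb divisibility and one-sided
symmetries, `G ∣ F`. (`dvd_of_weakReflection` with §1.)
[cite: Washington1997, §7.1–§7.2 and §13.4; Matsumura1987, Thm. 20.3] -/
theorem dvd_of_involutiveWeakReflection (hmax : IsLocalRing.maximalIdeal 𝒪 = Ideal.span {(p : 𝒪)})
    (ρ : PowerSeries (PowerSeries 𝒪) ≃+* PowerSeries (PowerSeries 𝒪)) (hρ2 : ∀ x, ρ (ρ x) = x)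
    (hρc : ∀ c : 𝒪, ρ (const 𝒪 c) = const 𝒪 c)
    (hρT : ρ (T₂ 𝒪) ∉ Ideal.span {const 𝒪 (p : 𝒪), T₂ 𝒪})
    (G F : PowerSeries (PowerSeries 𝒪)) (hG : G ∣ ρ G) (hF : F ∣ ρ F)
    (hcombI : ThinCombDvdInt 𝒪 p G F) : G ∣ F :=
  dvd_of_weakReflection 𝒪 p hmax ρ hρc hρT G F (associated_map_of_dvd_map ρ hρ2 hG)
    (associated_map_of_dvd_map ρ hρ2 hF) hcombI

omit hp in
/-- For an involutive weak reflection fixing constants, "`F` symmetric up to a power of `p`" is the same as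
"`F` symmetric": `Associated (ρ F) (p^d · F)` with `d ≠ 0` forces `F = 0` (so the `p`-power-relaxed variant of
K3(iii) contemplated in the line's census g3 is not a weakening for the intended `ρ`).
[cite: Washington1997, §7.1 and §13.4] -/
theorem eq_zero_of_associated_map_const_pow_mul (hmax : IsLocalRing.maximalIdeal 𝒪 = Ideal.span {(p : 𝒪)})
    (ρ : PowerSeries (PowerSeries 𝒪) ≃+* PowerSeries (PowerSeries 𝒪)) (hρ2 : ∀ x, ρ (ρ x) = x)
    (hρc : ∀ c : 𝒪, ρ (const 𝒪 c) = const 𝒪 c) {F : PowerSeries (PowerSeries 𝒪)} {d : ℕ} (hd : d ≠ 0)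
    (h : Associated (ρ F) (const 𝒪 ((p : 𝒪) ^ d) * F)) : F = 0 := by
  obtain ⟨_, hpu, _, _⟩ := p_ne_zero_of_maximalIdeal_eq 𝒪 p hmax
  have hcu : ¬ IsUnit (const 𝒪 (p : 𝒪)) := fun hu => by
    apply hpu
    have h1 := PowerSeries.isUnit_iff_constantCoeff.mp hu
    rw [const, RingHom.comp_apply, PowerSeries.constantCoeff_C] at h1
    have h2 := PowerSeries.isUnit_iff_constantCoeff.mp h1
    rwa [PowerSeries.constantCoeff_C] at h2
  rw [map_pow] at h
  rcases eq_zero_or_eq_zero_of_associated_map_pow_mul ρ hρ2 hcu (hρc _) h with h0 | h0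
  · exact absurd h0 hd
  · exact h0

end Rigidity

end Summit.BirchSwinnertonDyer.BirchSwinnertonDyer.Theorems.UniversalToricDescentThinComb.InvolutiveReflection

end
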